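import Mathlib
import Summits.Ventures.Crystal3D.Theorems.StickyWulffConstantLayerChainDefs
import Summits.Ventures.Crystal3D.Theorems.StickyWulffConstantStackingLiminfSliceHull
import HarnessLib

/-!
# Inner tent windows of the sections of `W_f` from vertex certificates (BLUEPRINT L4 for stub
# `stub_sliceDomination` of line `LayerChain`, crux `StackingLiminf`, stmt-Ventures-19145)

Route `StickyWulffConstant` of the venture `Summits/Ventures/Crystal3D` (cell `crystal3d-full`).
Over the landed vocabulary `StickyWulffConstantLayerChainDefs` (p473239): a zonotope certificate
`(s; t; u) ∈ [−1,1]⁹` with `∑ t = ∑ u = Z` places the point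
`∑ sᵢ aᵢ + (1−f) ∑ tᵢ b⁺ᵢ + f ∑ uᵢ b⁻ᵢ`, whose height is `√(2/3)·Z`, in `W_f`
(`mem_stackWulff_of_certificate`); this file spells out its planar coordinates
(`mem_stackSlice_of_certificate`) and certifies the six vertices of the section hexagons of
cf-p2 R19 (`BLUEPRINT-sliceDomination.md` §3 L4) on the three chambers.
WHAT THIS IS NOT: slice domination itself; rung F-C1 not moved.
-/

noncomputable section

namespace Summit.Ventures.Crystal3D.Theorems

open Set
open Summit.Ventures.Crystal3D.LayerChain

/-- **Certificate ⇒ membership in a section (planar form of BLUEPRINT L1).** -/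
theorem mem_stackSlice_of_certificate (f Z x yv : ℝ) (s t u : Fin 3 → ℝ)
    (hs : ∀ i, |s i| ≤ 1) (ht : ∀ i, |t i| ≤ 1) (hu : ∀ i, |u i| ≤ 1)
    (hts : (∑ i : Fin 3, t i) = Z) (hus : (∑ i : Fin 3, u i) = Z)
    (hx : x = (s 0 + s 1 / 2 - s 2 / 2) + (1 - f) * ((t 0 - t 1) / 2) - f * ((u 0 - u 1) / 2))
    (hy : yv = Real.sqrt 3 / 2 * (s 1 + s 2) + (1 - f) * (Real.sqrt 3 / 6 * (t 0 + t 1 - 2 * t 2)) -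
      f * (Real.sqrt 3 / 6 * (u 0 + u 1 - 2 * u 2))) :
    (x, yv) ∈ stackSlice f (Real.sqrt (2 / 3) * Z) := by
  show (![x, yv, Real.sqrt (2 / 3) * Z] : Fin 3 → ℝ) ∈ stackWulff f
  refine mem_stackWulff_of_certificate f _ s t u hs ht hu (hts.trans hus.symm) fun n => ?_
  simp only [Fin.sum_univ_three] at hts hus
  simp only [dot3, calibFlux, aVec, bPlus, bMinus, Fin.sum_univ_three, Fin.isValue,
    Matrix.cons_val_zero, Matrix.cons_val_one, Matrix.cons_val_two, Matrix.head_cons,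
    Matrix.tail_cons, hx, hy]
  rw [← hts]
  linear_combination (Real.sqrt (2 / 3) * n 2 * f) * hts - (Real.sqrt (2 / 3) * n 2 * f) * hus

/-- Componentwise bound for a vector literal. -/
theorem abs_vec3_le_one {a b c : ℝ} (ha : |a| ≤ 1) (hb : |b| ≤ 1) (hc : |c| ≤ 1) :
    ∀ i : Fin 3, |(![a, b, c] : Fin 3 → ℝ) i| ≤ 1 := by
  intro i; fin_cases i <;> simpa

/-- Sum of a vector literal. -/
theorem sum_vec3 (a b c : ℝ) : (∑ i : Fin 3, (![a, b, c] : Fin 3 → ℝ) i) = a + b + c := by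
  simp [Fin.sum_univ_three]

/-- **Inner tent window, chamber `|Z| ≤ 1` (BLUEPRINT L4, row `S_f(Z)` on `C0`).** With
`w = (1−2f)Z`: the hexagon with scaled data `lo = −3/2 + w/6`, `hi = 3/2 + w/6`, `m = −w/3`,
`P = 3` lies inside the section of `W_f` at height `√(2/3)·Z`. -/
theorem tentWindow_subset_stackSlice_mid (f Z : ℝ) (hf0 : 0 ≤ f) (hf1 : f ≤ 1) (hZ1 : -1 ≤ Z)
    (hZ2 : Z ≤ 1) :
    {p : ℝ × ℝ | Real.sqrt 3 * (-3 / 2 + (1 - 2 * f) * Z / 6) ≤ p.2 ∧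
        p.2 ≤ Real.sqrt 3 * (3 / 2 + (1 - 2 * f) * Z / 6) ∧
        |p.1| ≤ 3 - Real.sqrt 3 / 3 * |p.2 - Real.sqrt 3 * (-((1 - 2 * f) * Z / 3))|} ⊆
      stackSlice f (Real.sqrt (2 / 3) * Z) := by
  have h3 : Real.sqrt 3 * Real.sqrt 3 = 3 := Real.mul_self_sqrt (by norm_num)
  have hs : 0 < Real.sqrt 3 := Real.sqrt_pos.2 (by norm_num)
  have h1 : |(1 : ℝ)| ≤ 1 := by norm_num
  have hm1 : |(-1 : ℝ)| ≤ 1 := by norm_num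
  have hZ : |Z| ≤ 1 := abs_le.2 ⟨hZ1, hZ2⟩
  have hw : |(1 - 2 * f) * Z| ≤ 1 := by
    rw [abs_mul]
    have : |1 - 2 * f| ≤ 1 := abs_le.2 ⟨by linarith, by linarith⟩
    nlinarith [abs_nonneg (1 - 2 * f), abs_nonneg Z]
  set w := (1 - 2 * f) * Z with hw'
  -- the six vertices
  have hV1 : (-(3 / 2 + w / 2), Real.sqrt 3 * (-3 / 2 + w / 6)) ∈
      stackSlice f (Real.sqrt (2 / 3) * Z) :=
    mem_stackSlice_of_certificate f Z _ _ ![-1, -1, -1] ![-1, Z, 1] ![1, Z, -1]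
      (abs_vec3_le_one hm1 hm1 hm1) (abs_vec3_le_one hm1 hZ h1) (abs_vec3_le_one h1 hZ hm1)
      (by rw [sum_vec3]; ring) (by rw [sum_vec3]; ring) (by simp [hw']; ring) (by simp [hw']; ring)
  have hV2 : ((3 / 2 + w / 2), Real.sqrt 3 * (-3 / 2 + w / 6)) ∈
      stackSlice f (Real.sqrt (2 / 3) * Z) :=
    mem_stackSlice_of_certificate f Z _ _ ![1, -1, -1] ![Z, -1, 1] ![Z, 1, -1]
      (abs_vec3_le_one h1 hm1 hm1) (abs_vec3_le_one hZ hm1 h1) (abs_vec3_le_one hZ h1 hm1)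
      (by rw [sum_vec3]; ring) (by rw [sum_vec3]; ring) (by simp [hw']; ring) (by simp [hw']; ring)
  have hV3 : ((3 : ℝ), Real.sqrt 3 * (-(w / 3))) ∈ stackSlice f (Real.sqrt (2 / 3) * Z) :=
    mem_stackSlice_of_certificate f Z _ _ ![1, 1, -1] ![1, -1, Z] ![-1, 1, Z]
      (abs_vec3_le_one h1 h1 hm1) (abs_vec3_le_one h1 hm1 hZ) (abs_vec3_le_one hm1 h1 hZ)
      (by rw [sum_vec3]; ring) (by rw [sum_vec3]; ring) (by simp; ring) (by simp [hw']; ring)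
  have hV4 : ((3 / 2 - w / 2), Real.sqrt 3 * (3 / 2 + w / 6)) ∈
      stackSlice f (Real.sqrt (2 / 3) * Z) :=
    mem_stackSlice_of_certificate f Z _ _ ![1, 1, 1] ![1, Z, -1] ![-1, Z, 1]
      (abs_vec3_le_one h1 h1 h1) (abs_vec3_le_one h1 hZ hm1) (abs_vec3_le_one hm1 hZ h1)
      (by rw [sum_vec3]; ring) (by rw [sum_vec3]; ring) (by simp [hw']; ring) (by simp [hw']; ring)
  have hV5 : (-(3 / 2 - w / 2), Real.sqrt 3 * (3 / 2 + w / 6)) ∈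
      stackSlice f (Real.sqrt (2 / 3) * Z) :=
    mem_stackSlice_of_certificate f Z _ _ ![-1, 1, 1] ![Z, 1, -1] ![Z, -1, 1]
      (abs_vec3_le_one hm1 h1 h1) (abs_vec3_le_one hZ h1 hm1) (abs_vec3_le_one hZ hm1 h1)
      (by rw [sum_vec3]; ring) (by rw [sum_vec3]; ring) (by simp [hw']; ring) (by simp [hw']; ring)
  have hV6 : (-(3 : ℝ), Real.sqrt 3 * (-(w / 3))) ∈ stackSlice f (Real.sqrt (2 / 3) * Z) :=
    mem_stackSlice_of_certificate f Z _ _ ![-1, -1, 1] ![-1, 1, Z] ![1, -1, Z]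
      (abs_vec3_le_one hm1 hm1 h1) (abs_vec3_le_one hm1 h1 hZ) (abs_vec3_le_one h1 hm1 hZ)
      (by rw [sum_vec3]; ring) (by rw [sum_vec3]; ring) (by simp; ring) (by simp [hw']; ring)
  have habsw := abs_le.1 hw
  refine tentWindow_subset_of_convex (convex_stackSlice f _) (a := Real.sqrt 3 * (-3 / 2 + w / 6))
    (b := Real.sqrt 3 * (3 / 2 + w / 6)) (c := Real.sqrt 3 * (-(w / 3))) (P := 3)
    (κ := Real.sqrt 3 / 3) ?_ ?_ ?_ ?_ ?_ ?_ ?_ ?_ ?_ ?_ ?_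
  · nlinarith
  · nlinarith
  · positivity
  · nlinarith [h3]
  · nlinarith [h3]
  · convert hV1 using 2; nlinarith [h3]
  · convert hV2 using 2; nlinarith [h3]
  · exact hV3
  · convert hV4 using 2; nlinarith [h3]
  · convert hV5 using 2; nlinarith [h3]
  · exact hV6

/-- **Inner tent window, chamber `1 ≤ Z ≤ 3` (BLUEPRINT L4, row `S_f(Z)` on `C+`).** With
`s = 3 − Z`, `g = f s`: scaled data `lo = −1 − s/6 − g/6`, `hi = 1 + s/3 − g/6`, `m = −s/6 + g/3`,
`P = 2 + s/2`. -/
theorem tentWindow_subset_stackSlice_top (f Z : ℝ) (hf0 : 0 ≤ f) (hf1 : f ≤ 1) (hZ1 : 1 ≤ Z)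
    (hZ2 : Z ≤ 3) :
    {p : ℝ × ℝ | Real.sqrt 3 * (-1 - (3 - Z) / 6 - f * (3 - Z) / 6) ≤ p.2 ∧
        p.2 ≤ Real.sqrt 3 * (1 + (3 - Z) / 3 - f * (3 - Z) / 6) ∧
        |p.1| ≤ (2 + (3 - Z) / 2) -
          Real.sqrt 3 / 3 * |p.2 - Real.sqrt 3 * (-((3 - Z) / 6) + f * (3 - Z) / 3)|} ⊆
      stackSlice f (Real.sqrt (2 / 3) * Z) := by
  have h3 : Real.sqrt 3 * Real.sqrt 3 = 3 := Real.mul_self_sqrt (by norm_num)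
  have hs : 0 < Real.sqrt 3 := Real.sqrt_pos.2 (by norm_num)
  have h1 : |(1 : ℝ)| ≤ 1 := by norm_num
  have hm1 : |(-1 : ℝ)| ≤ 1 := by norm_num
  have hZ : |Z - 2| ≤ 1 := abs_le.2 ⟨by linarith, by linarith⟩
  set s := 3 - Z with hs'
  set g := f * (3 - Z) with hg'
  have hg0 : 0 ≤ g := by rw [hg']; exact mul_nonneg hf0 (by linarith)
  have hgs : g ≤ s := by rw [hg', hs']; nlinarith
  have hV1 : (-(1 + s / 2 - g / 2), Real.sqrt 3 * (-1 - s / 6 - g / 6)) ∈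
      stackSlice f (Real.sqrt (2 / 3) * Z) :=
    mem_stackSlice_of_certificate f Z _ _ ![-1, -1, -1] ![Z - 2, 1, 1] ![1, 1, Z - 2]
      (abs_vec3_le_one hm1 hm1 hm1) (abs_vec3_le_one hZ h1 h1) (abs_vec3_le_one h1 h1 hZ)
      (by rw [sum_vec3]; ring) (by rw [sum_vec3]; ring) (by simp [hs', hg']; ring)
      (by simp [hs', hg']; ring)
  have hV2 : ((1 + s / 2 - g / 2), Real.sqrt 3 * (-1 - s / 6 - g / 6)) ∈
      stackSlice f (Real.sqrt (2 / 3) * Z) :=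
    mem_stackSlice_of_certificate f Z _ _ ![1, -1, -1] ![1, Z - 2, 1] ![1, 1, Z - 2]
      (abs_vec3_le_one h1 hm1 hm1) (abs_vec3_le_one h1 hZ h1) (abs_vec3_le_one h1 h1 hZ)
      (by rw [sum_vec3]; ring) (by rw [sum_vec3]; ring) (by simp [hs', hg']; ring)
      (by simp [hs', hg']; ring)
  have hV3 : ((2 + s / 2), Real.sqrt 3 * (-(s / 6) + g / 3)) ∈
      stackSlice f (Real.sqrt (2 / 3) * Z) :=
    mem_stackSlice_of_certificate f Z _ _ ![1, 1, -1] ![1, Z - 2, 1] ![Z - 2, 1, 1]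
      (abs_vec3_le_one h1 h1 hm1) (abs_vec3_le_one h1 hZ h1) (abs_vec3_le_one hZ h1 h1)
      (by rw [sum_vec3]; ring) (by rw [sum_vec3]; ring) (by simp [hs']; ring)
      (by simp [hs', hg']; ring)
  have hV4 : ((1 + g / 2), Real.sqrt 3 * (1 + s / 3 - g / 6)) ∈
      stackSlice f (Real.sqrt (2 / 3) * Z) :=
    mem_stackSlice_of_certificate f Z _ _ ![1, 1, 1] ![1, 1, Z - 2] ![Z - 2, 1, 1]
      (abs_vec3_le_one h1 h1 h1) (abs_vec3_le_one h1 h1 hZ) (abs_vec3_le_one hZ h1 h1)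
      (by rw [sum_vec3]; ring) (by rw [sum_vec3]; ring) (by simp [hg']; ring)
      (by simp [hs', hg']; ring)
  have hV5 : (-(1 + g / 2), Real.sqrt 3 * (1 + s / 3 - g / 6)) ∈
      stackSlice f (Real.sqrt (2 / 3) * Z) :=
    mem_stackSlice_of_certificate f Z _ _ ![-1, 1, 1] ![1, 1, Z - 2] ![1, Z - 2, 1]
      (abs_vec3_le_one hm1 h1 h1) (abs_vec3_le_one h1 h1 hZ) (abs_vec3_le_one h1 hZ h1)
      (by rw [sum_vec3]; ring) (by rw [sum_vec3]; ring) (by simp [hg']; ring)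
      (by simp [hs', hg']; ring)
  have hV6 : (-(2 + s / 2), Real.sqrt 3 * (-(s / 6) + g / 3)) ∈
      stackSlice f (Real.sqrt (2 / 3) * Z) :=
    mem_stackSlice_of_certificate f Z _ _ ![-1, -1, 1] ![Z - 2, 1, 1] ![1, Z - 2, 1]
      (abs_vec3_le_one hm1 hm1 h1) (abs_vec3_le_one hZ h1 h1) (abs_vec3_le_one h1 hZ h1)
      (by rw [sum_vec3]; ring) (by rw [sum_vec3]; ring) (by simp [hs']; ring)
      (by simp [hs', hg']; ring)
  refine tentWindow_subset_of_convex (convex_stackSlice f _)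
    (a := Real.sqrt 3 * (-1 - s / 6 - g / 6)) (b := Real.sqrt 3 * (1 + s / 3 - g / 6))
    (c := Real.sqrt 3 * (-(s / 6) + g / 3)) (P := 2 + s / 2) (κ := Real.sqrt 3 / 3)
    ?_ ?_ ?_ ?_ ?_ ?_ ?_ ?_ ?_ ?_ ?_
  · nlinarith
  · nlinarith
  · positivity
  · nlinarith [h3]
  · nlinarith [h3]
  · convert hV1 using 2; nlinarith [h3]
  · convert hV2 using 2; nlinarith [h3]
  · exact hV3
  · convert hV4 using 2; nlinarith [h3]
  · convert hV5 using 2; nlinarith [h3]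
  · exact hV6

/-- **Inner tent window, chamber `−3 ≤ Z ≤ −1` (BLUEPRINT L4, row `S_f(Z)` on `C−`).** With
`s = 3 + Z`, `g = f s`: scaled data `lo = −1 − s/3 + g/6`, `hi = 1 + s/6 + g/6`, `m = s/6 − g/3`,
`P = 2 + s/2`. -/
theorem tentWindow_subset_stackSlice_bot (f Z : ℝ) (hf0 : 0 ≤ f) (hf1 : f ≤ 1) (hZ1 : -3 ≤ Z)
    (hZ2 : Z ≤ -1) :
    {p : ℝ × ℝ | Real.sqrt 3 * (-1 - (3 + Z) / 3 + f * (3 + Z) / 6) ≤ p.2 ∧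
        p.2 ≤ Real.sqrt 3 * (1 + (3 + Z) / 6 + f * (3 + Z) / 6) ∧
        |p.1| ≤ (2 + (3 + Z) / 2) -
          Real.sqrt 3 / 3 * |p.2 - Real.sqrt 3 * ((3 + Z) / 6 - f * (3 + Z) / 3)|} ⊆
      stackSlice f (Real.sqrt (2 / 3) * Z) := by
  have h3 : Real.sqrt 3 * Real.sqrt 3 = 3 := Real.mul_self_sqrt (by norm_num)
  have hs : 0 < Real.sqrt 3 := Real.sqrt_pos.2 (by norm_num)
  have h1 : |(1 : ℝ)| ≤ 1 := by norm_num
  have hm1 : |(-1 : ℝ)| ≤ 1 := by norm_num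
  have hZ : |Z + 2| ≤ 1 := abs_le.2 ⟨by linarith, by linarith⟩
  set s := 3 + Z with hs'
  set g := f * (3 + Z) with hg'
  have hg0 : 0 ≤ g := by rw [hg']; exact mul_nonneg hf0 (by linarith)
  have hgs : g ≤ s := by rw [hg', hs']; nlinarith
  have hV1 : (-(1 + g / 2), Real.sqrt 3 * (-1 - s / 3 + g / 6)) ∈
      stackSlice f (Real.sqrt (2 / 3) * Z) :=
    mem_stackSlice_of_certificate f Z _ _ ![-1, -1, -1] ![-1, -1, Z + 2] ![Z + 2, -1, -1]
      (abs_vec3_le_one hm1 hm1 hm1) (abs_vec3_le_one hm1 hm1 hZ) (abs_vec3_le_one hZ hm1 hm1)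
      (by rw [sum_vec3]; ring) (by rw [sum_vec3]; ring) (by simp [hg']; ring)
      (by simp [hs', hg']; ring)
  have hV2 : ((1 + g / 2), Real.sqrt 3 * (-1 - s / 3 + g / 6)) ∈
      stackSlice f (Real.sqrt (2 / 3) * Z) :=
    mem_stackSlice_of_certificate f Z _ _ ![1, -1, -1] ![-1, -1, Z + 2] ![-1, Z + 2, -1]
      (abs_vec3_le_one h1 hm1 hm1) (abs_vec3_le_one hm1 hm1 hZ) (abs_vec3_le_one hm1 hZ hm1)
      (by rw [sum_vec3]; ring) (by rw [sum_vec3]; ring) (by simp [hg']; ring)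
      (by simp [hs', hg']; ring)
  have hV3 : ((2 + s / 2), Real.sqrt 3 * (s / 6 - g / 3)) ∈
      stackSlice f (Real.sqrt (2 / 3) * Z) :=
    mem_stackSlice_of_certificate f Z _ _ ![1, 1, -1] ![Z + 2, -1, -1] ![-1, Z + 2, -1]
      (abs_vec3_le_one h1 h1 hm1) (abs_vec3_le_one hZ hm1 hm1) (abs_vec3_le_one hm1 hZ hm1)
      (by rw [sum_vec3]; ring) (by rw [sum_vec3]; ring) (by simp [hs']; ring)
      (by simp [hs', hg']; ring)
  have hV4 : ((1 + s / 2 - g / 2), Real.sqrt 3 * (1 + s / 6 + g / 6)) ∈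
      stackSlice f (Real.sqrt (2 / 3) * Z) :=
    mem_stackSlice_of_certificate f Z _ _ ![1, 1, 1] ![Z + 2, -1, -1] ![-1, -1, Z + 2]
      (abs_vec3_le_one h1 h1 h1) (abs_vec3_le_one hZ hm1 hm1) (abs_vec3_le_one hm1 hm1 hZ)
      (by rw [sum_vec3]; ring) (by rw [sum_vec3]; ring) (by simp [hs', hg']; ring)
      (by simp [hs', hg']; ring)
  have hV5 : (-(1 + s / 2 - g / 2), Real.sqrt 3 * (1 + s / 6 + g / 6)) ∈
      stackSlice f (Real.sqrt (2 / 3) * Z) :=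
    mem_stackSlice_of_certificate f Z _ _ ![-1, 1, 1] ![-1, Z + 2, -1] ![-1, -1, Z + 2]
      (abs_vec3_le_one hm1 h1 h1) (abs_vec3_le_one hm1 hZ hm1) (abs_vec3_le_one hm1 hm1 hZ)
      (by rw [sum_vec3]; ring) (by rw [sum_vec3]; ring) (by simp [hs', hg']; ring)
      (by simp [hs', hg']; ring)
  have hV6 : (-(2 + s / 2), Real.sqrt 3 * (s / 6 - g / 3)) ∈
      stackSlice f (Real.sqrt (2 / 3) * Z) :=
    mem_stackSlice_of_certificate f Z _ _ ![-1, -1, 1] ![-1, Z + 2, -1] ![Z + 2, -1, -1]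
      (abs_vec3_le_one hm1 hm1 h1) (abs_vec3_le_one hm1 hZ hm1) (abs_vec3_le_one hZ hm1 hm1)
      (by rw [sum_vec3]; ring) (by rw [sum_vec3]; ring) (by simp [hs']; ring)
      (by simp [hs', hg']; ring)
  refine tentWindow_subset_of_convex (convex_stackSlice f _)
    (a := Real.sqrt 3 * (-1 - s / 3 + g / 6)) (b := Real.sqrt 3 * (1 + s / 6 + g / 6))
    (c := Real.sqrt 3 * (s / 6 - g / 3)) (P := 2 + s / 2) (κ := Real.sqrt 3 / 3)
    ?_ ?_ ?_ ?_ ?_ ?_ ?_ ?_ ?_ ?_ ?_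
  · nlinarith
  · nlinarith
  · positivity
  · nlinarith [h3]
  · nlinarith [h3]
  · convert hV1 using 2; nlinarith [h3]
  · convert hV2 using 2; nlinarith [h3]
  · exact hV3
  · convert hV4 using 2; nlinarith [h3]
  · convert hV5 using 2; nlinarith [h3]
  · exact hV6

end Summit.Ventures.Crystal3D.Theorems

end
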